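import Mathlib.Analysis.InnerProductSpace.Basic
import HarnessLib

/-!
# BalabanUVNodes ∕ N15 — THE KING-MODEL RUNG (PART Ϥ-a): THE TREE ENGINE — a Poincaré inequality and a coercivity bound on an arbitrary finite ROOTED TREE
# (the abstract form of the tree ∕ axial ∕ comb gauge on a block: once the bonds of a spanning tree of contours are flat, the covariant Dirichlet form of the tree bonds plus
# the block-mean penalty control the whole `ℓ²` mass of the block, with an explicit constant `min(a, c∕(|V|·D))`)
# (Track A, DAG node N15 = NE2; FAN-OUT v1.1 §N15 s3 «KING-MODEL RUNG … + what the curved case adds»; count-neutral)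

HONEST FRAMING.  Count-neutral (cell `pub-ymgap`, seat `pub-ymgap-dag-n15-e` g49; `--supports stmt-QuantumFields-27247 --as helper` = K3ᴬ, KEY MAP v3).  Generic finite-dimensional
analysis (Mathlib only); the engine of PART Ϥ («THE COVARIANT BLOCK TERM AT EVERY LINK FIELD»): [Balaban1985BackgroundPropagators] (3.19) p.393 averages `λ` over a block after
PARALLEL TRANSPORT `R(U(Γ_{y,x}))` along contours `Γ_{y,x}` from the base point `y`; the contours of [Balaban1984PropagatorsI] (1.7) p.18 (first along `e₁`, then `e₂`, …; King's
(2.12) p.653 at one level) form a SPANNING TREE of the block rooted at `y`, and in the gauge in which the tree bonds are flat («Bałaban axial gauge», [Federbush1987PhaseCellIII]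
§5.3 p.303; tree `Federbush1986.CombGaugeObservation` on `ℤ^d` boxes) the covariant differences along tree bonds are plain differences.  What such a tree controls is decided
here once for all trees: nothing of Bałaban's (3.42); NOT a node discharge (N15 of record untouched); nothing continuum ∕ ℝ⁴ ∕ OS ∕ Clay.

THE MATHEMATICS.  A rooted tree on a finite vertex set `V` is a parent map with a depth function (`depth root = 0`, `depth(parent x) + 1 = depth x` off the root).  For
`w : V → E` (any inner-product space) put `T(w) = Σ_{x ≠ root}‖w(x) − w(parent x)‖²` (the tree Dirichlet form) and `w̄ = |V|⁻¹Σ_x w(x)`.  Telescoping along the path to the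
root and Cauchy–Schwarz give `‖w(x) − w(root)‖² ≤ depth(x)·Σ_{path(x)}‖∇w‖² ≤ depth(x)·T(w)` (§2: the path sum is a sub-sum of `T`, because the depth strictly decreases
along the path); the mean minimises `e ↦ Σ_x‖w(x) − e‖²` (§3), so `Σ_x‖w(x) − w̄‖² ≤ Σ_x‖w(x) − w(root)‖² ≤ |V|·D·T(w)` (`D` = a bound on the depth) — ★ THE TREE POINCARÉ
INEQUALITY; with `Σ_x‖w(x)‖² = |V|‖w̄‖² + Σ_x‖w(x) − w̄‖²` this yields ★★ THE TREE COERCIVITY BOUND `min(a, c∕(|V|D))·Σ_x‖w(x)‖² ≤ a|V|‖w̄‖² + c·T(w)` (`c ≥ 0`).  For a path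
of `N` vertices (`|V|·D = N(N−1)`) the constant is within `π²` of the true Fiedler value; for the comb of a `(d+1)`-cube of side `N` (`|V| = N^{d+1}`, `D = (d+1)(N−1)`) it is
`≍ N^{−(d+2)}`, the comb's true order (PART Ϥ-e exhibits the matching upper bound for the full covariant operator).
PROVED HERE: §1 `RootedTree` (structure: `root`, `parent`, `depth` + the three axioms), `depth_parent_lt`, `parent_ne_self`, def `pathSum` (well-founded along the depth), `pathSum_root`,
`pathSum_of_ne_root`, `pathSum_nonneg`, ★ `pathSum_le_sum` (a path sum is at most the total over all edges); §2 `sq_add_le_of_sq_le` (the weighted Cauchy–Schwarz step), ★★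
**`norm_sub_root_sq_le`** (`‖w x − w root‖² ≤ depth x · pathSum x`), ★ `norm_sub_root_sq_le_total`; §3 def `treeMean`, `card_smul_treeMean`, ★ `sum_norm_sub_sq_eq` (`Σ‖w x − e‖² =
Σ‖w x − w̄‖² + |V|‖w̄ − e‖²`), `sum_norm_sq_eq_mean_add`, `sum_norm_sub_treeMean_sq_le`; §4 ★★ **`tree_poincare`**, ★★★ **`tree_coercive`**.
Dedup (rg at filing): basename 0 files; needles `RootedTree|pathSum_le_sum|tree_poincare|tree_coercive|treeMean` 0 files in `Summits/QuantumFields/YangMills` + `Literature/MathematicalPhysics`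
(`pathSum` occurs as a LOCAL name in unrelated files; here it is namespaced).  presearch: n/a (elementary; the comb∕axial gauge is [Balaban1984PropagatorsI] (1.7), [Federbush1987PhaseCellIII] §5.3).
Locators: [Balaban1985BackgroundPropagators] (3.19) p.393, p.395 l.1–3; [Balaban1984PropagatorsI] (1.7) p.18; [King1986] (2.11)–(2.12) p.653; [Federbush1987PhaseCellIII] §5.3 p.303.  0 `sorry`.
-/

noncomputable section
open scoped BigOperators
open Finset

namespace Summit.QuantumFields.YangMills.BalabanUVNodes.N15KingModelRung.CovariantBlock

/-! ## §1 Rooted trees and path sums -/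

/-- A ROOTED TREE on a vertex type `V`: a parent map and a depth function with `depth root = 0`, `depth (parent x) + 1 = depth x` for `x ≠ root`, and only the root at
depth `0` (so iterating `parent` from any vertex reaches the root after `depth x` steps, through distinct vertices).  The tree of contours `Γ_{y,x}` of a block is the example.
[cite: Balaban1984PropagatorsI, (1.7) p.18; Federbush1987PhaseCellIII, §5.3 p.303] -/
structure RootedTree (V : Type*) where
  /-- the base point of the contours -/
  root : V
  /-- the previous vertex on the contour from the root -/
  parent : V → V
  /-- the number of bonds of the contour from the root -/
  depth : V → ℕ
  depth_root : depth root = 0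
  depth_parent : ∀ x, x ≠ root → depth (parent x) + 1 = depth x
  eq_root_of_depth_eq_zero : ∀ x, depth x = 0 → x = root

variable {V : Type*} (T : RootedTree V)

/-- The depth strictly decreases along the parent map. [folklore] -/
theorem RootedTree.depth_parent_lt {x : V} (hx : x ≠ T.root) : T.depth (T.parent x) < T.depth x := by
  have := T.depth_parent x hx; omega

/-- No vertex off the root is its own parent. [folklore] -/
theorem RootedTree.parent_ne_self {x : V} (hx : x ≠ T.root) : T.parent x ≠ x := by
  intro h; have := T.depth_parent_lt hx; rw [h] at this; exact lt_irrefl _ this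

/-- Off the root the depth is positive. [folklore] -/
theorem RootedTree.depth_pos {x : V} (hx : x ≠ T.root) : 0 < T.depth x := by
  have := T.depth_parent x hx; omega

variable [DecidableEq V]

/-- THE PATH SUM of an edge function `f` (edge `z` = the bond `(parent z, z)`) along the contour from `x` up to the root: `f x + f (parent x) + ⋯` (`depth x` terms).
[cite: Balaban1984PropagatorsI, (1.7) p.18] -/
def pathSum (f : V → ℝ) (x : V) : ℝ :=
  if _hx : x = T.root then 0 else f x + pathSum f (T.parent x)
termination_by T.depth x
decreasing_by exact T.depth_parent_lt (by assumption)

/-- The root's path is empty. [folklore] -/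
theorem pathSum_root (f : V → ℝ) : pathSum T f T.root = 0 := by
  rw [pathSum]; simp

/-- One step up the contour. [folklore] -/
theorem pathSum_of_ne_root (f : V → ℝ) {x : V} (hx : x ≠ T.root) : pathSum T f x = f x + pathSum T f (T.parent x) := by
  rw [pathSum, dif_neg hx]

/-- Path sums of non-negative edge functions are non-negative. [folklore] -/
theorem pathSum_nonneg {f : V → ℝ} (hf : ∀ z, 0 ≤ f z) : ∀ x, 0 ≤ pathSum T f x := by
  suffices h : ∀ n x, T.depth x ≤ n → 0 ≤ pathSum T f x from fun x => h _ x le_rfl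
  intro n
  induction n with
  | zero => intro x hx; rw [T.eq_root_of_depth_eq_zero x (Nat.le_zero.mp hx), pathSum_root]
  | succ n ih =>
    intro x hx
    by_cases h : x = T.root
    · rw [h, pathSum_root]
    · rw [pathSum_of_ne_root T f h]
      have := T.depth_parent x h
      exact add_nonneg (hf x) (ih _ (by omega))

variable [Fintype V]

/-- ★ A PATH SUM IS A SUB-SUM OF THE TOTAL: for `f ≥ 0`, `pathSum f x ≤ Σ_{z ≠ root} f z` — the contour from `x` to the root passes through DISTINCT vertices (the depth drops by one
at each step), so each edge is used at most once. [cite: Balaban1984PropagatorsI, (1.7) p.18] -/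
theorem pathSum_le_sum {f : V → ℝ} (hf : ∀ z, 0 ≤ f z) (x : V) : pathSum T f x ≤ ∑ z ∈ univ.filter (fun z => z ≠ T.root), f z := by
  -- sharper: the path of `x` only uses vertices of depth `≤ depth x`
  suffices h : ∀ n x, T.depth x ≤ n → pathSum T f x ≤ ∑ z ∈ univ.filter (fun z => z ≠ T.root ∧ T.depth z ≤ T.depth x), f z by
    refine (h _ x le_rfl).trans (Finset.sum_le_sum_of_subset_of_nonneg (fun z hz => ?_) fun z _ _ => hf z)
    simp only [Finset.mem_filter, Finset.mem_univ, true_and] at hz ⊢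
    exact hz.1
  intro n
  induction n with
  | zero =>
    intro x hx
    rw [T.eq_root_of_depth_eq_zero x (Nat.le_zero.mp hx), pathSum_root]
    exact Finset.sum_nonneg fun z _ => hf z
  | succ n ih =>
    intro x hx
    by_cases h : x = T.root
    · rw [h, pathSum_root]; exact Finset.sum_nonneg fun z _ => hf z
    · rw [pathSum_of_ne_root T f h]
      have hdp := T.depth_parent x h
      have hsub : insert x (univ.filter (fun z => z ≠ T.root ∧ T.depth z ≤ T.depth (T.parent x)))
          ⊆ univ.filter (fun z => z ≠ T.root ∧ T.depth z ≤ T.depth x) := by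
        intro z hz
        rcases Finset.mem_insert.mp hz with rfl | hz
        · simp [h]
        · simp only [Finset.mem_filter, Finset.mem_univ, true_and] at hz ⊢
          exact ⟨hz.1, by omega⟩
      have hnot : x ∉ univ.filter (fun z => z ≠ T.root ∧ T.depth z ≤ T.depth (T.parent x)) := by
        simp only [Finset.mem_filter, Finset.mem_univ, true_and, not_and, not_le]; intro; omega
      calc f x + pathSum T f (T.parent x)
          ≤ f x + ∑ z ∈ univ.filter (fun z => z ≠ T.root ∧ T.depth z ≤ T.depth (T.parent x)), f z := by
            gcongr; exact ih _ (by omega)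
        _ = ∑ z ∈ insert x (univ.filter (fun z => z ≠ T.root ∧ T.depth z ≤ T.depth (T.parent x))), f z := (Finset.sum_insert hnot).symm
        _ ≤ _ := Finset.sum_le_sum_of_subset_of_nonneg hsub fun z _ _ => hf z

/-! ## §2 Telescoping: the distance to the root is controlled by the path sum -/

/-- THE WEIGHTED CAUCHY–SCHWARZ STEP: `β² ≤ k·P` (`k, P, β ≥ 0`) ⟹ `(α + β)² ≤ (k+1)(α² + P)` (for `k > 0`: `k(k+1)(α²+P) − k(α+β)² ≥ (kα − β)²`). [folklore] -/
theorem sq_add_le_of_sq_le {α β k P : ℝ} (hβ : 0 ≤ β) (hk : 0 ≤ k) (hP : 0 ≤ P) (h : β ^ 2 ≤ k * P) :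
    (α + β) ^ 2 ≤ (k + 1) * (α ^ 2 + P) := by
  rcases eq_or_lt_of_le hk with rfl | hk'
  · have hb : β = 0 := by nlinarith
    subst hb; nlinarith
  · have key : k * ((k + 1) * (α ^ 2 + P)) - k * (α + β) ^ 2 ≥ 0 := by nlinarith [sq_nonneg (k * α - β)]
    nlinarith

variable {𝕜 : Type*} [RCLike 𝕜] {E : Type*} [NormedAddCommGroup E] [InnerProductSpace 𝕜 E]

omit [Fintype V] in
/-- ★★ **TELESCOPING ALONG THE CONTOUR**: `‖w(x) − w(root)‖² ≤ depth(x)·Σ_{z ∈ path(x)}‖w(z) − w(parent z)‖²` (triangle inequality along the `depth x` bonds of the contour and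
Cauchy–Schwarz). [cite: Balaban1984PropagatorsI, (1.7) p.18; Balaban1985BackgroundPropagators, (3.19) p.393] -/
theorem norm_sub_root_sq_le (w : V → E) (x : V) :
    ‖w x - w T.root‖ ^ 2 ≤ T.depth x * pathSum T (fun z => ‖w z - w (T.parent z)‖ ^ 2) x := by
  suffices h : ∀ n x, T.depth x ≤ n → ‖w x - w T.root‖ ^ 2 ≤ T.depth x * pathSum T (fun z => ‖w z - w (T.parent z)‖ ^ 2) x from h _ x le_rfl
  intro n
  induction n with
  | zero =>
    intro x hx
    have hx0 := Nat.le_zero.mp hx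
    rw [T.eq_root_of_depth_eq_zero x hx0, sub_self, norm_zero, T.depth_root]; simp
  | succ n ih =>
    intro x hx
    by_cases h : x = T.root
    · rw [h, sub_self, norm_zero, T.depth_root]; simp
    · have hdp := T.depth_parent x h
      have hP0 := pathSum_nonneg T (f := fun z => ‖w z - w (T.parent z)‖ ^ 2) (fun _ => sq_nonneg _) (T.parent x)
      have hih := ih (T.parent x) (by omega)
      rw [pathSum_of_ne_root T _ h]
      have hk : (T.depth x : ℝ) = (T.depth (T.parent x) : ℝ) + 1 := by rw [← hdp]; push_cast; ring
      rw [hk]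
      have htri : ‖w x - w T.root‖ ≤ ‖w x - w (T.parent x)‖ + ‖w (T.parent x) - w T.root‖ := by
        have := norm_add_le (w x - w (T.parent x)) (w (T.parent x) - w T.root)
        rwa [sub_add_sub_cancel] at this
      calc ‖w x - w T.root‖ ^ 2 ≤ (‖w x - w (T.parent x)‖ + ‖w (T.parent x) - w T.root‖) ^ 2 := by gcongr
        _ ≤ ((T.depth (T.parent x) : ℝ) + 1) * (‖w x - w (T.parent x)‖ ^ 2 + pathSum T (fun z => ‖w z - w (T.parent z)‖ ^ 2) (T.parent x)) :=
            sq_add_le_of_sq_le (norm_nonneg _) (Nat.cast_nonneg _) hP0 hih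

/-- ★ `‖w(x) − w(root)‖² ≤ depth(x)·T(w)`, `T(w) = Σ_{z ≠ root}‖w(z) − w(parent z)‖²` the whole tree Dirichlet form. [cite: Balaban1984PropagatorsI, (1.7) p.18] -/
theorem norm_sub_root_sq_le_total (w : V → E) (x : V) :
    ‖w x - w T.root‖ ^ 2 ≤ T.depth x * ∑ z ∈ univ.filter (fun z => z ≠ T.root), ‖w z - w (T.parent z)‖ ^ 2 :=
  (norm_sub_root_sq_le T w x).trans (mul_le_mul_of_nonneg_left (pathSum_le_sum T (fun _ => sq_nonneg _) x) (Nat.cast_nonneg _))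

/-! ## §3 The mean of a block of vectors -/

omit [DecidableEq V] in
/-- THE MEAN `w̄ = |V|⁻¹Σ_x w(x)` (the block average after transport, [Balaban1985BackgroundPropagators] (3.19)). [cite: Balaban1985BackgroundPropagators, (3.19) p.393] -/
def treeMean (w : V → E) : E := ((Fintype.card V : 𝕜)⁻¹) • ∑ x, w x

omit [DecidableEq V] in
/-- `|V|·w̄ = Σ_x w(x)` (non-empty vertex set; a rooted tree's contains the root). [folklore] -/
theorem card_smul_treeMean [Nonempty V] (w : V → E) : (Fintype.card V : 𝕜) • treeMean (𝕜 := 𝕜) w = ∑ x, w x := by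
  have hV : (Fintype.card V : 𝕜) ≠ 0 := by exact_mod_cast Fintype.card_pos.ne'
  rw [treeMean, smul_smul, mul_inv_cancel₀ hV, one_smul]

omit [DecidableEq V] in
/-- ★ THE VARIANCE IDENTITY: `Σ_x‖w(x) − e‖² = Σ_x‖w(x) − w̄‖² + |V|·‖w̄ − e‖²` for every `e` (the cross term `2ReΣ_x⟪w(x) − w̄, w̄ − e⟫` vanishes). [folklore] -/
theorem sum_norm_sub_sq_eq [Nonempty V] (w : V → E) (e : E) :
    ∑ x, ‖w x - e‖ ^ 2 = ∑ x, ‖w x - treeMean (𝕜 := 𝕜) w‖ ^ 2 + Fintype.card V * ‖treeMean (𝕜 := 𝕜) w - e‖ ^ 2 := by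
  set m : E := treeMean (𝕜 := 𝕜) w with hm
  have hsplit : ∀ x, w x - e = (w x - m) + (m - e) := fun x => by abel
  have hzero : ∑ x, (w x - m) = 0 := by
    rw [Finset.sum_sub_distrib, Finset.sum_const, Finset.card_univ, ← Nat.cast_smul_eq_nsmul 𝕜, hm, card_smul_treeMean, sub_self]
  calc ∑ x, ‖w x - e‖ ^ 2 = ∑ x, (‖w x - m‖ ^ 2 + 2 * RCLike.re (inner 𝕜 (w x - m) (m - e)) + ‖m - e‖ ^ 2) := by
        refine Finset.sum_congr rfl fun x _ => ?_
        rw [hsplit x]; exact norm_add_sq (𝕜 := 𝕜) _ _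
    _ = ∑ x, ‖w x - m‖ ^ 2 + 2 * RCLike.re (inner 𝕜 (∑ x, (w x - m)) (m - e)) + Fintype.card V * ‖m - e‖ ^ 2 := by
        rw [Finset.sum_add_distrib, Finset.sum_add_distrib, Finset.sum_const, Finset.card_univ, nsmul_eq_mul, ← Finset.mul_sum, sum_inner, map_sum]
    _ = ∑ x, ‖w x - m‖ ^ 2 + Fintype.card V * ‖m - e‖ ^ 2 := by rw [hzero, inner_zero_left, map_zero, mul_zero, add_zero]

omit [DecidableEq V] in
/-- `Σ_x‖w(x)‖² = |V|·‖w̄‖² + Σ_x‖w(x) − w̄‖²` (the case `e = 0`). [folklore] -/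
theorem sum_norm_sq_eq_mean_add [Nonempty V] (w : V → E) :
    ∑ x, ‖w x‖ ^ 2 = Fintype.card V * ‖treeMean (𝕜 := 𝕜) w‖ ^ 2 + ∑ x, ‖w x - treeMean (𝕜 := 𝕜) w‖ ^ 2 := by
  have h := sum_norm_sub_sq_eq (𝕜 := 𝕜) w 0
  simp only [sub_zero] at h
  rw [h]; ring

omit [DecidableEq V] in
/-- The mean minimises the sum of squared distances: `Σ_x‖w(x) − w̄‖² ≤ Σ_x‖w(x) − e‖²`. [folklore] -/
theorem sum_norm_sub_treeMean_sq_le [Nonempty V] (w : V → E) (e : E) : ∑ x, ‖w x - treeMean (𝕜 := 𝕜) w‖ ^ 2 ≤ ∑ x, ‖w x - e‖ ^ 2 := by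
  rw [sum_norm_sub_sq_eq (𝕜 := 𝕜) w e]
  have : 0 ≤ (Fintype.card V : ℝ) * ‖treeMean (𝕜 := 𝕜) w - e‖ ^ 2 := by positivity
  linarith

/-! ## §4 The tree Poincaré inequality and the tree coercivity bound -/

/-- ★★ **THE TREE POINCARÉ INEQUALITY**: if every vertex has depth `≤ D`, then `Σ_x‖w(x) − w̄‖² ≤ |V|·D·Σ_{z ≠ root}‖w(z) − w(parent z)‖²` — the mass orthogonal to the constants
is controlled by the Dirichlet form OF THE TREE BONDS ALONE (constant `(|V|D)⁻¹`; a path of `N` vertices has Fiedler value `2 − 2cos(π∕N) ≤ π²(|V|D)⁻¹`).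
[cite: Balaban1984PropagatorsI, (1.7) p.18; Balaban1985BackgroundPropagators, (3.19) p.393, p.395 l.1–3] -/
theorem tree_poincare {D : ℕ} (hD : ∀ x, T.depth x ≤ D) (w : V → E) :
    ∑ x, ‖w x - treeMean (𝕜 := 𝕜) w‖ ^ 2 ≤ (Fintype.card V * D : ℝ) * ∑ z ∈ univ.filter (fun z => z ≠ T.root), ‖w z - w (T.parent z)‖ ^ 2 := by
  haveI : Nonempty V := ⟨T.root⟩
  set Tw := ∑ z ∈ univ.filter (fun z => z ≠ T.root), ‖w z - w (T.parent z)‖ ^ 2 with hTw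
  have hT0 : 0 ≤ Tw := Finset.sum_nonneg fun z _ => sq_nonneg _
  calc ∑ x, ‖w x - treeMean (𝕜 := 𝕜) w‖ ^ 2 ≤ ∑ x, ‖w x - w T.root‖ ^ 2 := sum_norm_sub_treeMean_sq_le w (w T.root)
    _ ≤ ∑ x : V, (D : ℝ) * Tw := Finset.sum_le_sum fun x _ =>
        (norm_sub_root_sq_le_total T w x).trans (mul_le_mul_of_nonneg_right (by exact_mod_cast hD x) hT0)
    _ = (Fintype.card V * D : ℝ) * Tw := by rw [Finset.sum_const, Finset.card_univ, nsmul_eq_mul]; ring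

/-- ★★★ **THE TREE COERCIVITY BOUND**: for `c ≥ 0`, any real `a` and depth `≤ D`,
`min(a, c∕(|V|·D))·Σ_x‖w(x)‖² ≤ a·|V|·‖w̄‖² + c·Σ_{z ≠ root}‖w(z) − w(parent z)‖²` — the block-mean penalty holds the constants, the tree bonds hold the rest.  (In PART Ϥ-d: `w` is a
field on a block transported to the base point along the contours, `a|V|‖w̄‖²` is King's ∕ Bałaban's `a·Q(U)^*Q(U)` term and the tree sum is the covariant Dirichlet form of the contour
bonds.) [cite: Balaban1985BackgroundPropagators, (3.19) p.393, (3.24) p.394, p.395 l.1–3; King1986, (2.13) p.653] -/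
theorem tree_coercive {a c : ℝ} (hc : 0 ≤ c) {D : ℕ} (hD : ∀ x, T.depth x ≤ D) (w : V → E) :
    min a (c / (Fintype.card V * D)) * ∑ x, ‖w x‖ ^ 2
      ≤ a * (Fintype.card V * ‖treeMean (𝕜 := 𝕜) w‖ ^ 2) + c * ∑ z ∈ univ.filter (fun z => z ≠ T.root), ‖w z - w (T.parent z)‖ ^ 2 := by
  haveI : Nonempty V := ⟨T.root⟩
  set Tw := ∑ z ∈ univ.filter (fun z => z ≠ T.root), ‖w z - w (T.parent z)‖ ^ 2 with hTw
  set R := ∑ x, ‖w x - treeMean (𝕜 := 𝕜) w‖ ^ 2 with hR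
  set B := (Fintype.card V : ℝ) * ‖treeMean (𝕜 := 𝕜) w‖ ^ 2 with hB
  have hT0 : 0 ≤ Tw := Finset.sum_nonneg fun z _ => sq_nonneg _
  have hR0 : 0 ≤ R := Finset.sum_nonneg fun z _ => sq_nonneg _
  have hB0 : 0 ≤ B := by positivity
  have hsplit : ∑ x, ‖w x‖ ^ 2 = B + R := sum_norm_sq_eq_mean_add w
  have hP : R ≤ (Fintype.card V * D : ℝ) * Tw := tree_poincare T hD w
  set VD : ℝ := (Fintype.card V * D : ℝ) with hVD
  have hVD0 : 0 ≤ VD := by positivity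
  rw [hsplit, mul_add]
  have h1 : min a (c / VD) * B ≤ a * B := mul_le_mul_of_nonneg_right (min_le_left _ _) hB0
  have h2 : min a (c / VD) * R ≤ c * Tw := by
    rcases eq_or_lt_of_le hVD0 with h0 | hpos
    · -- degenerate: `|V|·D = 0` forces `R = 0`
      have hR' : R = 0 := le_antisymm (by rw [← h0, zero_mul] at hP; exact hP) hR0
      rw [hR', mul_zero]; exact mul_nonneg hc hT0
    · calc min a (c / VD) * R ≤ (c / VD) * R := mul_le_mul_of_nonneg_right (min_le_right _ _) hR0
        _ ≤ (c / VD) * (VD * Tw) := mul_le_mul_of_nonneg_left hP (div_nonneg hc hVD0)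
        _ = c * Tw := by field_simp
  linarith

end Summit.QuantumFields.YangMills.BalabanUVNodes.N15KingModelRung.CovariantBlock

end
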